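import Literature.NumberTheory.Automorphic.UnitaryGroupSymplecticEmbedding
import Literature.NumberTheory.Automorphic.UnitaryGroupFormTransport

/-!
# Hyperbolic frame vectors: the columns of `T⁻¹` for a form congruence `H = σ(T)ᵀ·A·T`, their Gram values, how frame-conjugates act on them,
# and the lift to `V ⊗ W` along `e : Fin N × Fin 1 ≃ Fin n` (LOCAL SEAM of s23, inert package, organ (L24-b) (F2), generic part)

Track B ∕ K2-LIT, hLiu418 = stmt-HodgeConjecture-24832; LEAD F0P6-plan (g11) «M-155g» (ii) ∕ «M-155i» ((L24-b) by ROAD A′: (T) ★ p857345, then (F2) = the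
frame inputs `(y, ys)`, `(hgy)`, `(hgb)` of ★ (C3′) `F0P2oDoubledSwapSiegel.exists_involution_forall_isSiegelDelta` at `n = 2`). Helper (count-neutral, own
head per LEAD R3), PURE MATRIX ALGEBRA over a commutative ring `R` with a ring endomorphism `σ` (the tree's ★ `hermForm σ H x y = (σ ∘ x) ⬝ᵥ (H *ᵥ y)` and ★
`formCongr σ T H = (σT)ᵀ·H·T`):
* `hermForm_formCongr_frameVec`: for `H = formCongr σ T A` the frame vectors `yᵢ := T⁻¹eᵢ` have Gram matrix `A`: `h(yᵢ, yⱼ) = A i j` — with `A = antidiag(1,1)`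
  this is the hyperbolic pair `h(y₀,y₀) = 0`, `h(y₀,y₁) = h(y₁,y₀) = 1` of ★ #27i's frame `hTJ`;
* `conj_mulVec_frameVec`: `(T⁻¹·M·T)·yᵢ = T⁻¹·(M eᵢ)`, so a frame-upper-triangular element scales `y₀` by its corner (`conj_mulVec_frameVec_of_apply_one_zero`);
* `reindex_kronecker_one_mulVec_lift`: on `V ⊗ W` (`dim W = 1`, enumeration `e`), `reindex e e (M ⊗ 1)` acts on the lift `b ↦ y (e⁻¹ b).1` as `M` acts on `y`;
* `hermForm_reindex_kronecker_lift`: the `V ⊗ W` form `reindex e e (H ⊗ (c))` evaluates on lifts as `c·h(y, y′)`.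
[GelbartRogawski1991, §3.2 p. 457]; [MoeglinVignerasWaldspurger1987, Chap. 1 I.17]. No `def`, no `sorry`. HONEST LABEL: HC_CM is proved only modulo the
printed citations (2 remaining named inputs: hLiu418 = stmt-HodgeConjecture-24832, h413 = stmt-HodgeConjecture-24833) until rung 0 closes; this file is
unconditional and moves no counter.
-/

set_option autoImplicit false

set_option linter.dupNamespace false

noncomputable section

open scoped Matrix Kronecker
open Matrix

namespace Summit.HodgeConjecture.HodgeConjecture.Cruxes.HLiu418.K2LiuHyperbolicFrameVectors

open Literature.NumberTheory.Automorphic Literature.NumberTheory.Automorphic.UnitaryGroup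

variable {R : Type*} [CommRing R] (σ : R →+* R) {n : ℕ}

/-- `σ` commutes with `Pi.single i 1`. [folklore] -/
theorem comp_single_one (i : Fin n) : (σ : R → R) ∘ (Pi.single i (1 : R)) = Pi.single i 1 := by
  funext k
  by_cases hk : k = i
  · subst hk; simp
  · simp [Pi.single_eq_of_ne hk]

/-- **The frame vectors `yᵢ = T⁻¹ eᵢ` of a form congruence `H = σ(T)ᵀ A T` have Gram matrix `A`**: `h(yᵢ, yⱼ) = A i j`
(`h = hermForm σ H`). For `A = antidiag(1,1)`: `(y₀, y₁)` is a hyperbolic pair. [cite: GelbartRogawski1991, §3.2 p. 457] -/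
theorem hermForm_formCongr_frameVec (T : GL (Fin n) R) (A : Matrix (Fin n) (Fin n) R) (i j : Fin n) :
    hermForm σ (formCongr σ T A)
        (((T⁻¹ : GL (Fin n) R) : Matrix (Fin n) (Fin n) R) *ᵥ Pi.single i 1)
        (((T⁻¹ : GL (Fin n) R) : Matrix (Fin n) (Fin n) R) *ᵥ Pi.single j 1) = A i j := by
  have hTT : (T : Matrix (Fin n) (Fin n) R) * ((T⁻¹ : GL (Fin n) R) : Matrix (Fin n) (Fin n) R) = 1 := by
    rw [← Units.val_mul, mul_inv_cancel, Units.val_one]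
  have hσTT : ((T : Matrix (Fin n) (Fin n) R).map σ) * (((T⁻¹ : GL (Fin n) R) : Matrix (Fin n) (Fin n) R).map σ) = 1 :=
    GLn.map_val_mul_map_val_inv σ T
  have hσx : (σ : R → R) ∘ (((T⁻¹ : GL (Fin n) R) : Matrix (Fin n) (Fin n) R) *ᵥ Pi.single i 1) =
      (((T⁻¹ : GL (Fin n) R) : Matrix (Fin n) (Fin n) R).map σ) *ᵥ Pi.single i 1 := by
    funext k
    rw [Function.comp_apply, RingHom.map_mulVec, comp_single_one]
  unfold hermForm formCongr
  rw [hσx, Matrix.mulVec_mulVec, Matrix.mul_assoc _ (T : Matrix (Fin n) (Fin n) R), hTT, Matrix.mul_one, Matrix.dotProduct_mulVec,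
    ← Matrix.vecMul_vecMul, Matrix.vecMul_transpose, Matrix.mulVec_mulVec, hσTT, Matrix.one_mulVec, ← Matrix.dotProduct_mulVec,
    single_one_dotProduct, Matrix.mulVec_single_one, Matrix.col_apply]

/-- **Frame conjugates act through the frame**: `(T⁻¹ M T)·(T⁻¹ eᵢ) = T⁻¹·(M eᵢ)`. [folklore] -/
theorem conj_mulVec_frameVec (T : GL (Fin n) R) (M : Matrix (Fin n) (Fin n) R) (i : Fin n) :
    (((T⁻¹ : GL (Fin n) R) : Matrix (Fin n) (Fin n) R) * M * (T : Matrix (Fin n) (Fin n) R)) *ᵥ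
        (((T⁻¹ : GL (Fin n) R) : Matrix (Fin n) (Fin n) R) *ᵥ Pi.single i 1) =
      ((T⁻¹ : GL (Fin n) R) : Matrix (Fin n) (Fin n) R) *ᵥ (M *ᵥ Pi.single i 1) := by
  have hTT : (T : Matrix (Fin n) (Fin n) R) * ((T⁻¹ : GL (Fin n) R) : Matrix (Fin n) (Fin n) R) = 1 := by
    rw [← Units.val_mul, mul_inv_cancel, Units.val_one]
  rw [Matrix.mulVec_mulVec, Matrix.mul_assoc _ (T : Matrix (Fin n) (Fin n) R), hTT, Matrix.mul_one, ← Matrix.mulVec_mulVec]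

/-- **A frame-upper-triangular element scales `y₀`**: if the first column of `M` is `M₀₀ e₀` (`M k 0 = 0` for `k ≠ 0`), then
`(T⁻¹ M T)·y₀ = M₀₀ · y₀`. [folklore] -/
theorem conj_mulVec_frameVec_of_apply_zero [NeZero n] (T : GL (Fin n) R) (M : Matrix (Fin n) (Fin n) R) (hM : ∀ k : Fin n, k ≠ 0 → M k 0 = 0) :
    (((T⁻¹ : GL (Fin n) R) : Matrix (Fin n) (Fin n) R) * M * (T : Matrix (Fin n) (Fin n) R)) *ᵥ
        (((T⁻¹ : GL (Fin n) R) : Matrix (Fin n) (Fin n) R) *ᵥ Pi.single 0 1) =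
      M 0 0 • (((T⁻¹ : GL (Fin n) R) : Matrix (Fin n) (Fin n) R) *ᵥ Pi.single 0 1) := by
  have hMe : M *ᵥ (Pi.single 0 1 : Fin n → R) = M 0 0 • (Pi.single 0 1 : Fin n → R) := by
    ext k
    rw [Matrix.mulVec_single_one, Matrix.col_apply, Pi.smul_apply, smul_eq_mul]
    by_cases hk : k = 0
    · subst hk; simp
    · rw [hM k hk, Pi.single_eq_of_ne hk, mul_zero]
  rw [conj_mulVec_frameVec, hMe, Matrix.mulVec_smul]

/-! ## The lift to `V ⊗ W` along `e : Fin N × Fin 1 ≃ Fin m` -/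

/-- **`reindex e e (M ⊗ 1)` acts on lifted vectors as `M`**: for `Y b := y (e⁻¹ b).1`, `(reindex e e (M ⊗ₖ 1)) Y = lift (M y)`.
[cite: MoeglinVignerasWaldspurger1987, Chap. 1 I.17] -/
theorem reindex_kronecker_one_mulVec_lift {N m : ℕ} (e : Fin N × Fin 1 ≃ Fin m) (M : Matrix (Fin N) (Fin N) R) (y : Fin N → R) :
    (Matrix.reindex e e (M ⊗ₖ (1 : Matrix (Fin 1) (Fin 1) R))) *ᵥ (fun b => y (e.symm b).1) = fun b => (M *ᵥ y) (e.symm b).1 := by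
  ext b
  have h2 : (e.symm b).2 = 0 := Subsingleton.elim _ _
  simp only [Matrix.mulVec, dotProduct]
  rw [← e.sum_comp, Fintype.sum_prod_type]
  simp only [Matrix.reindex_apply, Matrix.submatrix_apply, Equiv.symm_apply_apply, Matrix.kroneckerMap_apply, Fin.sum_univ_one]
  refine Finset.sum_congr rfl fun k _ => ?_
  rw [h2, Matrix.one_apply_eq, mul_one]

/-- **The `V ⊗ W` form on lifted vectors**: for a `1 × 1` form `(c)` on `W` and lifts `Y b := y (e⁻¹ b).1`, `Y′ b := y′ (e⁻¹ b).1`,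
`hermForm σ (reindex e e (H ⊗ₖ (c))) Y Y′ = c · hermForm σ H y y′`. [cite: GelbartRogawski1991, §3.2 p. 457] -/
theorem hermForm_reindex_kronecker_lift {N m : ℕ} (e : Fin N × Fin 1 ≃ Fin m) (H : Matrix (Fin N) (Fin N) R) (c : R) (y y' : Fin N → R) :
    hermForm σ (Matrix.reindex e e (H ⊗ₖ (Matrix.of fun _ _ : Fin 1 => c))) (fun b => y (e.symm b).1) (fun b => y' (e.symm b).1) =
      c * hermForm σ H y y' := by
  have hmv : ∀ a : Fin N, (Matrix.reindex e e (H ⊗ₖ (Matrix.of fun _ _ : Fin 1 => c)) *ᵥ fun b => y' (e.symm b).1) (e (a, 0)) =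
      c * (H *ᵥ y') a := by
    intro a
    simp only [Matrix.mulVec, dotProduct]
    rw [← e.sum_comp, Fintype.sum_prod_type, Finset.mul_sum]
    simp only [Matrix.reindex_apply, Matrix.submatrix_apply, Equiv.symm_apply_apply, Matrix.kroneckerMap_apply, Matrix.of_apply,
      Fin.sum_univ_one]
    exact Finset.sum_congr rfl fun k _ => by ring
  unfold hermForm
  simp only [dotProduct]
  rw [← e.sum_comp, Fintype.sum_prod_type, Finset.mul_sum]
  simp only [Function.comp_apply, Equiv.symm_apply_apply, Fin.sum_univ_one]
  exact Finset.sum_congr rfl fun a _ => by rw [hmv a]; ring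

end Summit.HodgeConjecture.HodgeConjecture.Cruxes.HLiu418.K2LiuHyperbolicFrameVectors

end
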